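import Mathlib
import HarnessLib
import Summits.QuantumFields.YangMills.Theorems.ComplexCouplingChannelContinuumLegGivenGapProductToUniformDefs

/-!
# `ContinuumLegGivenGap` (stmt-QuantumFields-15828), line `alternating-curvature-arrays`: `stub_ptuDerivatives`, helper 2 — level numerics, supports of the cut-offs and tensor bumps, cell geometry

Support file for the registered stub `stub_ptuDerivatives` (derivative bounds of the Whitney system of
`stub_productToUniform`).  The normaliser `W = near + out + ∑∑ φ*` is differentiated at points of the support of
one enlarged bump `φ̃_{m,v,z}`; this file supplies the SUPPORT GEOMETRY that makes the sum locally a sum of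
`≤ 2 + 3 (2p+1)^4` terms of comparable scale:

* §1 level numerics (`m ∈ ptuLevels L p`): `3^m > 64(2p+1)`, `d ≥ 32`, `cellSide m ≤ 2(2p+1) d`, `3^m ≤ 3L`,
  `2(2 + d/8) ≤ cellSide m`; the level comparison `15·3^{m'} ≤ 57·3^m ⇒ m' ≤ m+1`;
* §2 supports: the cores `physCore` are closed; `tsupport ptuCut ⊆ physCore` for depth `e ≥ 2` with `2e ≤ cellSide`
  (so for `χ` and `χ̃`); on `tsupport φ̃` and `tsupport φ*` every point `yᵢ` lies in the core of its cell; `φ̃` has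
  compact support;
* §3 cell geometry in the cores: cells `≥ 16` apart give points `≥ 15 ℓ` apart in some coordinate, cells `≤ 56` apart
  give points `≤ 57 ℓ` apart in every coordinate, a point lies in the core of at most ONE cell; consequences: bumps
  `φ̃_m` and `φ*_{m'}` with a common support point have `|m - m'| ≤ 1` (registered anchor `ptuDeriv_levels_close`),
  and a point all of whose pairs are `> R a` apart in some coordinate is off `tsupport near`.

Mathlib + the landed Defs only; no definitions. [folklore]
-/

set_option autoImplicit false

noncomputable section

open scoped Classical

namespace Summit.QuantumFields.YangMills.Theorems.ContinuumLegGivenGap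

open scoped BigOperators ContDiff
open Filter Topology Set
open Summit.QuantumFields.YangMills.Theorems.ContinuumLegGivenGap.AlternatingArrays

/-! ## §1 Level numerics -/

/-- A Whitney level has `3^m > 64(2p+1)`. [folklore] -/
theorem ptuDeriv_level_pow_gt {L p m : ℕ} (hm : m ∈ ptuLevels L p) : 64 * (2 * p + 1) < 3 ^ m := by
  have h := (Finset.mem_filter.1 hm).2
  unfold ptuM0 at h
  exact (Nat.lt_pow_succ_log_self (by norm_num) _).trans_le (Nat.pow_le_pow_right (by norm_num) h)

/-- A Whitney level is below the torus: `3^m ≤ 2L+1`. [folklore] -/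
theorem ptuDeriv_level_pow_le {L p m : ℕ} (hm : m ∈ ptuLevels L p) : 3 ^ m ≤ 2 * L + 1 := by
  have h := Finset.mem_range.1 (Finset.mem_filter.1 hm).1
  exact (Nat.pow_le_pow_right (by norm_num) h.le).trans (Nat.pow_log_le_self 3 (by omega))

/-- The offset step of a Whitney level is `≥ 32`. [folklore] -/
theorem ptuDeriv_level_D_ge {L p m : ℕ} (hm : m ∈ ptuLevels L p) : 32 ≤ ptuD m p := by
  unfold ptuD
  rw [Nat.le_div_iff_mul_le (by positivity)]
  have h := ptuDeriv_level_pow_gt hm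
  omega

/-- The cell side of a Whitney level is at most `2(2p+1)` offset steps: `cellSide m ≤ 2(2p+1) d`. [folklore] -/
theorem ptuDeriv_cellSide_le_D {L p m : ℕ} (hm : m ∈ ptuLevels L p) :
    cellSide m ≤ 2 * (2 * (p : ℝ) + 1) * (ptuD m p : ℝ) := by
  have hd := ptuDeriv_level_D_ge hm
  have h1 : 3 ^ m < 2 * (2 * p + 1) * (ptuD m p + 1) := Nat.lt_mul_div_succ _ (by positivity)
  have h2 : 3 ^ m ≤ 4 * (2 * p + 1) * ptuD m p := by nlinarith
  have h3 : ((3 : ℕ) ^ m : ℝ) ≤ (4 * (2 * p + 1) * ptuD m p : ℕ) := by exact_mod_cast h2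
  unfold cellSide
  push_cast at h3
  linarith

/-- The physical cell side is at most `3aL/2`: `3^m ≤ 3L` for a Whitney level (`L ≥ 1`). [folklore] -/
theorem ptuDeriv_level_pow_le_L {L p m : ℕ} (hm : m ∈ ptuLevels L p) (hL : 1 ≤ L) : (3 : ℝ) ^ m ≤ 3 * (L : ℝ) := by
  have h := ptuDeriv_level_pow_le hm
  have h' : ((3 : ℕ) ^ m : ℝ) ≤ ((2 * L + 1 : ℕ) : ℝ) := by exact_mod_cast h
  push_cast at h'
  have hL' : (1 : ℝ) ≤ L := by exact_mod_cast hL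
  linarith

/-- The inner depth fits in the cell: `2(2 + d/8) ≤ cellSide m` (`p ≥ 2`). [folklore] -/
theorem ptuDeriv_depth_le {L p m : ℕ} (hm : m ∈ ptuLevels L p) (hp : 2 ≤ p) :
    2 * (2 + (ptuD m p : ℝ) / 8) ≤ cellSide m := by
  have hpow := ptuDeriv_level_pow_gt hm
  have hpow' : ((64 * (2 * p + 1) : ℕ) : ℝ) < ((3 : ℕ) ^ m : ℝ) := by exact_mod_cast hpow
  push_cast at hpow'
  have hp' : (2 : ℝ) ≤ p := by exact_mod_cast hp
  have hd : (ptuD m p : ℝ) ≤ (3 : ℝ) ^ m / (2 * (2 * (p : ℝ) + 1)) := by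
    have h := Nat.cast_div_le (m := 3 ^ m) (n := 2 * (2 * p + 1)) (α := ℝ)
    unfold ptuD
    push_cast at h
    exact h
  have hd' : (ptuD m p : ℝ) ≤ (3 : ℝ) ^ m / 10 :=
    hd.trans (div_le_div_of_nonneg_left (by positivity) (by norm_num) (by linarith))
  have h320 : (320 : ℝ) ≤ (3 : ℝ) ^ m := by nlinarith
  unfold cellSide
  linarith

/-- **Level comparison**: `15 · 3^{m'} ≤ 57 · 3^m` forces `m' ≤ m + 1`. [folklore] -/
theorem ptuDeriv_level_le_of_pow_le {m m' : ℕ} (h : (15 : ℝ) * 3 ^ m' ≤ 57 * 3 ^ m) : m' ≤ m + 1 := by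
  by_contra hc
  have hle : m + 2 ≤ m' := by omega
  have hpow : (3 : ℝ) ^ (m + 2) ≤ 3 ^ m' := pow_le_pow_right₀ (by norm_num) hle
  have h9 : (3 : ℝ) ^ (m + 2) = 9 * 3 ^ m := by ring
  have hpos : (0 : ℝ) < 3 ^ m := by positivity
  linarith

/-! ## §2 Supports -/

/-- The coordinates of `ℝ⁴` are continuous. [folklore] -/
theorem ptuDeriv_continuous_coord (μ : Fin 4) : Continuous fun u : EuclideanSpace ℝ (Fin 4) => u μ :=
  (EuclideanSpace.proj (𝕜 := ℝ) μ).continuous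

/-- The cores are closed. [folklore] -/
theorem ptuDeriv_isClosed_physCore (a : ℝ) (m : ℕ) (v z : Fin 4 → ℤ) : IsClosed (physCore a m v z) := by
  unfold physCore
  simp only [Set.setOf_forall, Set.setOf_and]
  exact isClosed_iInter fun μ => (isClosed_le continuous_const (ptuDeriv_continuous_coord μ)).inter
    (isClosed_le (ptuDeriv_continuous_coord μ) continuous_const)

/-- **The one-point cut-off of depth `e ≥ 2` with `2e ≤ cellSide m` is supported in the core.** [folklore] -/
theorem ptuDeriv_tsupport_cut_subset {a : ℝ} (ha : 0 < a) (m : ℕ) (v z : Fin 4 → ℤ) {e : ℝ} (w : ℝ) (he : 2 ≤ e)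
    (heS : 2 * e ≤ cellSide m) : tsupport (ptuCut a m v z e w) ⊆ physCore a m v z := by
  refine closure_minimal (fun u hu μ => ?_) (ptuDeriv_isClosed_physCore a m v z)
  have h := ptuCut_mem_uIcc hu μ
  have hle : a * ((v μ : ℝ) + cellSide m * (z μ : ℝ) + e) ≤ a * ((v μ : ℝ) + cellSide m * ((z μ : ℝ) + 1) - e) :=
    mul_le_mul_of_nonneg_left (by linarith) ha.le
  rw [Set.uIcc_of_le hle, Set.mem_Icc] at h
  have h1 : a * ((v μ : ℝ) + cellSide m * (z μ : ℝ) + 2) ≤ a * ((v μ : ℝ) + cellSide m * (z μ : ℝ) + e) :=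
    mul_le_mul_of_nonneg_left (by linarith) ha.le
  have h2 : a * ((v μ : ℝ) + cellSide m * ((z μ : ℝ) + 1) - e) ≤ a * ((v μ : ℝ) + cellSide m * ((z μ : ℝ) + 1) - 2) :=
    mul_le_mul_of_nonneg_left (by linarith) ha.le
  exact ⟨h1.trans h.1, h.2.trans h2⟩

/-- The outer cut-off `χ̃` of a Whitney piece is supported in the core. [folklore] -/
theorem ptuDeriv_tsupport_chiTilde_subset {a : ℝ} (ha : 0 < a) {L p m : ℕ} (hm : m ∈ ptuLevels L p) (hp : 2 ≤ p)
    (v z : Fin 4 → ℤ) : tsupport (ptuChiTildeFun a m p v z) ⊆ physCore a m v z := by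
  have h := ptuDeriv_depth_le hm hp
  have hd : (0 : ℝ) ≤ (ptuD m p : ℝ) := Nat.cast_nonneg _
  exact ptuDeriv_tsupport_cut_subset ha m v z _ le_rfl (by linarith)

/-- The inner cut-off `χ` of a Whitney piece is supported in the core. [folklore] -/
theorem ptuDeriv_tsupport_chi_subset {a : ℝ} (ha : 0 < a) {L p m : ℕ} (hm : m ∈ ptuLevels L p) (hp : 2 ≤ p)
    (v z : Fin 4 → ℤ) : tsupport (ptuChiFun a m p v z) ⊆ physCore a m v z := by
  have hd : (0 : ℝ) ≤ (ptuD m p : ℝ) := Nat.cast_nonneg _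
  exact ptuDeriv_tsupport_cut_subset ha m v z _ (by linarith) (ptuDeriv_depth_le hm hp)

/-- A tensor product of one-point functions is supported where every factor is. [folklore] -/
theorem ptuDeriv_tsupport_tensor_subset {p : ℕ} (f : Fin p → EuclideanSpace ℝ (Fin 4) → ℝ) (S : Fin p → Set (EuclideanSpace ℝ (Fin 4)))
    (hS : ∀ i, IsClosed (S i)) (hf : ∀ i, tsupport (f i) ⊆ S i) :
    tsupport (fun y : (Fin p → EuclideanSpace ℝ (Fin 4)) => ∏ i, f i (y i)) ⊆ {y | ∀ i, y i ∈ S i} := by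
  have hcl : IsClosed {y : (Fin p → EuclideanSpace ℝ (Fin 4)) | ∀ i, y i ∈ S i} := by
    simp only [Set.setOf_forall]
    exact isClosed_iInter fun i => (hS i).preimage (continuous_apply i)
  refine closure_minimal (fun y hy i => ?_) hcl
  exact hf i (subset_closure ((Finset.prod_ne_zero_iff.1 hy) i (Finset.mem_univ i)))

/-- **On `tsupport φ̃_{m,v,z}` every point `yᵢ` lies in the core of the cell `zᵢ`.** [folklore] -/
theorem ptuDeriv_tsupport_phiTilde {a : ℝ} (ha : 0 < a) {L p m : ℕ} (hm : m ∈ ptuLevels L p) (hp : 2 ≤ p)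
    (v : Fin 4 → ℤ) (z : Fin p → Fin 4 → ℤ) {y : (Fin p → EuclideanSpace ℝ (Fin 4))}
    (hy : y ∈ tsupport (ptuPhiTilde a m p v z)) : ∀ i, y i ∈ physCore a m v (z i) :=
  ptuDeriv_tsupport_tensor_subset (fun i => ptuChiTildeFun a m p v (z i)) (fun i => physCore a m v (z i))
    (fun i => ptuDeriv_isClosed_physCore a m v (z i)) (fun i => ptuDeriv_tsupport_chiTilde_subset ha hm hp v (z i)) hy

/-- **On `tsupport φ*_{m,v,z}` every point `yᵢ` lies in the core of the cell `zᵢ`.** [folklore] -/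
theorem ptuDeriv_tsupport_phiStar {a : ℝ} (ha : 0 < a) {L p m : ℕ} (hm : m ∈ ptuLevels L p) (hp : 2 ≤ p)
    (v : Fin 4 → ℤ) (z : Fin p → Fin 4 → ℤ) {y : (Fin p → EuclideanSpace ℝ (Fin 4))}
    (hy : y ∈ tsupport (ptuPhiStar a m p v z)) : ∀ i, y i ∈ physCore a m v (z i) :=
  ptuDeriv_tsupport_tensor_subset (fun i => ptuChiFun a m p v (z i)) (fun i => physCore a m v (z i))
    (fun i => ptuDeriv_isClosed_physCore a m v (z i)) (fun i => ptuDeriv_tsupport_chi_subset ha hm hp v (z i)) hy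

/-- The enlarged tensor bump has compact support (a product of compactly supported one-point factors). [folklore] -/
theorem ptuDeriv_phiTilde_hasCompactSupport (a : ℝ) (m p : ℕ) (v : Fin 4 → ℤ) (z : Fin p → Fin 4 → ℤ) :
    HasCompactSupport (ptuPhiTilde a m p v z) := by
  have hK : IsCompact (Set.pi Set.univ fun i : Fin p => tsupport (ptuChiTildeFun a m p v (z i))) :=
    isCompact_univ_pi fun i => ptuCut_hasCompactSupport a m v (z i) 2 ((ptuD m p : ℝ) / 8)
  refine HasCompactSupport.of_support_subset_isCompact hK fun y hy => ?_
  simp only [Set.mem_pi, Set.mem_univ, true_implies]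
  intro i
  exact subset_closure ((Finset.prod_ne_zero_iff.1 hy) i (Finset.mem_univ i))

/-! ## §3 Cell geometry in the cores -/

/-- Cells `≥ 16` apart: two core points differ by `≥ 15 ℓ` in some coordinate. [folklore] -/
theorem ptuDeriv_physCore_far {a : ℝ} (ha : 0 < a) (m : ℕ) (v z z' : Fin 4 → ℤ) (hzz : (16 : ℝ) ≤ ‖z - z'‖)
    {u u' : EuclideanSpace ℝ (Fin 4)} (hu : u ∈ physCore a m v z) (hu' : u' ∈ physCore a m v z') :
    ∃ μ, 15 * (a * cellSide m) ≤ |u μ - u' μ| := by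
  have hS : 0 ≤ cellSide m := by unfold cellSide; positivity
  have haS : 0 ≤ a * cellSide m := mul_nonneg ha.le hS
  obtain ⟨μ, hμ⟩ : ∃ μ, (16 : ℝ) ≤ ‖(z - z') μ‖ := by
    by_contra hc
    push Not at hc
    have hlt : ‖z - z'‖ < 16 := (pi_norm_lt_iff (by norm_num)).2 hc
    linarith
  refine ⟨μ, ?_⟩
  rw [Pi.sub_apply, Int.norm_eq_abs, Int.cast_sub] at hμ
  obtain ⟨h1, h2⟩ := hu μ
  obtain ⟨h1', h2'⟩ := hu' μ
  rcases le_abs.1 hμ with h | h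
  · have hk : (16 : ℝ) * (a * cellSide m) ≤ a * cellSide m * ((z μ : ℝ) - (z' μ : ℝ)) := by nlinarith
    rw [le_abs]
    left
    nlinarith
  · have hk : (16 : ℝ) * (a * cellSide m) ≤ a * cellSide m * ((z' μ : ℝ) - (z μ : ℝ)) := by nlinarith
    rw [le_abs]
    right
    nlinarith

/-- Cells `≤ 56` apart: two core points differ by `≤ 57 ℓ` in every coordinate. [folklore] -/
theorem ptuDeriv_physCore_close {a : ℝ} (ha : 0 < a) (m : ℕ) (v z z' : Fin 4 → ℤ) (hzz : ‖z - z'‖ ≤ (56 : ℝ))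
    {u u' : EuclideanSpace ℝ (Fin 4)} (hu : u ∈ physCore a m v z) (hu' : u' ∈ physCore a m v z') :
    ∀ μ, |u μ - u' μ| ≤ 57 * (a * cellSide m) := by
  intro μ
  have hS : 0 ≤ cellSide m := by unfold cellSide; positivity
  have haS : 0 ≤ a * cellSide m := mul_nonneg ha.le hS
  have hμ : ‖(z - z') μ‖ ≤ 56 := (norm_le_pi_norm _ μ).trans hzz
  rw [Pi.sub_apply, Int.norm_eq_abs, Int.cast_sub, abs_le] at hμ
  obtain ⟨h1, h2⟩ := hu μ
  obtain ⟨h1', h2'⟩ := hu' μ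
  have hk1 : a * cellSide m * ((z μ : ℝ) - (z' μ : ℝ)) ≤ 56 * (a * cellSide m) := by nlinarith
  have hk2 : a * cellSide m * ((z' μ : ℝ) - (z μ : ℝ)) ≤ 56 * (a * cellSide m) := by nlinarith
  rw [abs_le]
  constructor <;> nlinarith

/-- **A point lies in the core of at most one cell** (same level, same offset). [folklore] -/
theorem ptuDeriv_physCore_unique {a : ℝ} (ha : 0 < a) (m : ℕ) (v z z' : Fin 4 → ℤ) {u : EuclideanSpace ℝ (Fin 4)}
    (hu : u ∈ physCore a m v z) (hu' : u ∈ physCore a m v z') : z = z' := by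
  funext μ
  have hS : 0 < cellSide m := by unfold cellSide; positivity
  obtain ⟨h1, h2⟩ := hu μ
  obtain ⟨h1', h2'⟩ := hu' μ
  have k1 : cellSide m * ((z μ : ℝ) - (z' μ : ℝ)) < cellSide m * 1 := by nlinarith
  have k2 : cellSide m * ((z' μ : ℝ) - (z μ : ℝ)) < cellSide m * 1 := by nlinarith
  have k1' : (z μ : ℝ) - (z' μ : ℝ) < 1 := lt_of_mul_lt_mul_left k1 hS.le
  have k2' : (z' μ : ℝ) - (z μ : ℝ) < 1 := lt_of_mul_lt_mul_left k2 hS.le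
  have i1 : ((z μ - z' μ : ℤ) : ℝ) < 1 := by push_cast; linarith
  have i2 : ((z' μ - z μ : ℤ) : ℝ) < 1 := by push_cast; linarith
  have i1' : z μ - z' μ < 1 := by exact_mod_cast i1
  have i2' : z' μ - z μ < 1 := by exact_mod_cast i2
  omega

/-- **Overlapping pieces have adjacent levels** (registered anchor): if a point lies on the support of the enlarged
bump `φ̃` of a level-`m` piece and on the support of the bump `φ*` of a level-`m'` piece, then `|m - m'| ≤ 1`
(both scale windows contain the closest-pair separation of the point). [folklore] -/
theorem ptuDeriv_levels_close : ∀ (a : ℝ) (L p m m' : ℕ), 0 < a → 2 ≤ p → m ∈ ptuLevels L p → m' ∈ ptuLevels L p →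
    ∀ vz ∈ ptuIdx L m p, ∀ vz' ∈ ptuIdx L m' p, ∀ y : (Fin p → EuclideanSpace ℝ (Fin 4)),
      y ∈ tsupport (ptuPhiTilde a m p vz.1 vz.2) → y ∈ tsupport (ptuPhiStar a m' p vz'.1 vz'.2) →
      m' ≤ m + 1 ∧ m ≤ m' + 1 := by
  intro a L p m m' ha hp hm hm' vz hvz vz' hvz' y hy hy'
  have hc := ptuDeriv_tsupport_phiTilde ha hm hp vz.1 vz.2 hy
  have hc' := ptuDeriv_tsupport_phiStar ha hm' hp vz'.1 vz'.2 hy'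
  obtain ⟨-, hfar, i, j, hij, hclose⟩ := (Finset.mem_filter.1 hvz).2
  obtain ⟨-, hfar', i', j', hij', hclose'⟩ := (Finset.mem_filter.1 hvz').2
  have hS : ∀ n : ℕ, a * cellSide n = a / 2 * 3 ^ n := fun n => by unfold cellSide; ring
  constructor
  · -- the close pair of `vz` is far for `vz'`
    obtain ⟨μ, hμ⟩ := ptuDeriv_physCore_far ha m' vz'.1 (vz'.2 i) (vz'.2 j) (hfar' i j hij) (hc' i) (hc' j)
    have hμ' := ptuDeriv_physCore_close ha m vz.1 (vz.2 i) (vz.2 j) hclose (hc i) (hc j) μ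
    refine ptuDeriv_level_le_of_pow_le ?_
    rw [hS] at hμ hμ'
    have key : a / 2 * (15 * 3 ^ m') ≤ a / 2 * (57 * 3 ^ m) := by nlinarith [hμ.trans hμ']
    exact le_of_mul_le_mul_left key (by positivity)
  · obtain ⟨μ, hμ⟩ := ptuDeriv_physCore_far ha m vz.1 (vz.2 i') (vz.2 j') (hfar i' j' hij') (hc i') (hc j')
    have hμ' := ptuDeriv_physCore_close ha m' vz'.1 (vz'.2 i') (vz'.2 j') hclose' (hc' i') (hc' j') μ
    refine ptuDeriv_level_le_of_pow_le ?_
    rw [hS] at hμ hμ'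
    have key : a / 2 * (15 * 3 ^ m) ≤ a / 2 * (57 * 3 ^ m') := by nlinarith [hμ.trans hμ']
    exact le_of_mul_le_mul_left key (by positivity)

/-- **Off the near region**: a configuration all of whose pairs are `> R a` apart in some coordinate is not in
`tsupport near` (there `near` vanishes identically nearby). [folklore] -/
theorem ptuDeriv_not_mem_tsupport_near {a : ℝ} (ha : 0 < a) {p : ℕ} {y : (Fin p → EuclideanSpace ℝ (Fin 4))}
    (h : ∀ i j : Fin p, i ≠ j → ∃ μ, (ptuR p : ℝ) * a < |y i μ - y j μ|) : y ∉ tsupport (ptuNear a p) := by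
  set prs := (Finset.univ : Finset (Fin p × Fin p)).filter (fun ij => ij.1 < ij.2) with hprs
  set C : Set (Fin p → EuclideanSpace ℝ (Fin 4)) :=
    ⋃ ij ∈ prs, {y' | ∀ μ, |y' ij.1 μ - y' ij.2 μ| ≤ (ptuR p : ℝ) * a} with hC
  have hCcl : IsClosed C := by
    refine Set.Finite.isClosed_biUnion (Finset.finite_toSet prs) fun ij _ => ?_
    simp only [Set.setOf_forall]
    refine isClosed_iInter fun μ => ?_
    have hcont : Continuous fun y' : (Fin p → EuclideanSpace ℝ (Fin 4)) => y' ij.1 μ - y' ij.2 μ :=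
      ((ptuDeriv_continuous_coord μ).comp (continuous_apply ij.1)).sub
        ((ptuDeriv_continuous_coord μ).comp (continuous_apply ij.2))
    exact isClosed_le (continuous_abs.comp hcont) continuous_const
  have hsub : Function.support (ptuNear a p) ⊆ C := by
    intro y' hy'
    rw [Function.mem_support] at hy'
    unfold ptuNear at hy'
    have hne : ∏ ij ∈ prs, (1 - ∏ μ : Fin 4, ptuPlateau (-((ptuR p : ℝ) * a)) ((ptuR p : ℝ) * a)
        ((ptuR p : ℝ) * a / 4) ((y' ij.1 - y' ij.2) μ)) ≠ 1 := fun h1 => hy' (by rw [h1, sub_self])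
    obtain ⟨ij, hij, hval⟩ : ∃ ij ∈ prs, (1 - ∏ μ : Fin 4, ptuPlateau (-((ptuR p : ℝ) * a)) ((ptuR p : ℝ) * a)
        ((ptuR p : ℝ) * a / 4) ((y' ij.1 - y' ij.2) μ)) ≠ 1 := by
      by_contra hall
      push Not at hall
      exact hne (Finset.prod_eq_one hall)
    have hprod : ∏ μ : Fin 4, ptuPlateau (-((ptuR p : ℝ) * a)) ((ptuR p : ℝ) * a) ((ptuR p : ℝ) * a / 4)
        ((y' ij.1 - y' ij.2) μ) ≠ 0 := fun h0 => hval (by rw [h0, sub_zero])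
    refine Set.mem_biUnion hij fun μ => ?_
    have hμ := ptuPlateau_mem_uIcc ((Finset.prod_ne_zero_iff.1 hprod) μ (Finset.mem_univ μ))
    have hRa : -((ptuR p : ℝ) * a) ≤ (ptuR p : ℝ) * a := by
      have : (0 : ℝ) ≤ (ptuR p : ℝ) * a := by positivity
      linarith
    rw [Set.uIcc_of_le hRa, Set.mem_Icc, PiLp.sub_apply] at hμ
    exact abs_le.2 hμ
  intro hy
  have hyC : y ∈ C := closure_minimal hsub hCcl hy
  simp only [hC, Set.mem_iUnion, Set.mem_setOf_eq, exists_prop] at hyC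
  obtain ⟨ij, hij, hle⟩ := hyC
  have hlt : ij.1 < ij.2 := (Finset.mem_filter.1 hij).2
  obtain ⟨μ, hμ⟩ := h ij.1 ij.2 (ne_of_lt hlt)
  linarith [hle μ]

end Summit.QuantumFields.YangMills.Theorems.ContinuumLegGivenGap

end
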